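import Summits.CriticalPhenomena.CardyFormulaZ2.Theses.CardyRotToConf
import Literature.Probability.RandomPlanarGeometry.SLESixMoebiusIdentification
import Literature.Probability.RandomPlanarGeometry.SLELawOfDrivingProcess
import Literature.Probability.RandomPlanarGeometry.CritPercSLESwallowedProofs
import Mathlib.MeasureTheory.Measure.HasOuterApproxClosed
import Mathlib.MeasureTheory.Constructions.BorelSpace.Metrizable
import HarnessLib

/-!
# Stub `stub_sleSixMoebiusLocality` (crux stmt-CriticalPhenomena-0698, line germ-label-transport)

The half-plane target-independence of chordal SLE₆ (G. F. Lawler (2005), §6.3, Thm. 6.13 /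
Prop. 6.14 for the Möbius map `Φ_x(z) = xz/(z + x)`), in the strengthened form of an **equality of
laws as Borel measures on curve classes**, together with the almost-everywhere measurability of the
two stopped-class maps on Wiener space (`sleSix_moebius_stoppedPathClass_law_eq`); the registered
stub `stub_sleSixMoebiusLocality : sle_six_moebius_locality` (equality on every measurable set of
classes) follows by `Measure.map_apply_of_aemeasurable`.

Proof of the law equality (independent of the tree's `SLESixMoebiusLocalityProofs.lean`, through
the measurable stopped-trace functional): for the localising times `ρ_n ↑ T_{-x}`
(`SLESixMoebius.tendsto_locTime`), the almost sure identification
`SLESixMoebius.ae_stoppedPathClass_eq_stoppedTraceClass` exhibits the class of `Φ_x ∘ γ|[0, ρ_n]`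
as the measurable functional `stoppedTraceClass x x² n` of the path `√6 B̂` of a Brownian motion on
the product space, whose law is that of the SLE₆ driving function
(`map_eq_map_sleDriving_of_isPreBrownianReal`); the same functional of the SLE₆ driving function
is the class of `γ` stopped at its intrinsic localising time, which tends to `T_x`
(`SLESixMoebius.tendsto_pointLocTime`). Both stopped classes converge almost surely (SLE₆ avoids
the pole, `ae_notMem_range_sleTrace`; swallowing is hitting,
`swallowingTime_ofReal_eq_firstHit_of_ne`), which gives the a.e. measurability of the limits and,
by dominated convergence against bounded continuous test functions, the equality of the limit
laws (`ext_of_forall_lintegral_eq_of_IsFiniteMeasure`).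

## References

* G. F. Lawler, *Conformally Invariant Processes in the Plane*, AMS (2005), §6.3, Thm. 6.13,
  Prop. 6.14. [Lawler2005]
-/

noncomputable section

open MeasureTheory ProbabilityTheory Filter Set Function Complex
open Literature.Probability.RandomPlanarGeometry Literature.Probability.Process
open Literature.Probability.RandomPlanarGeometry.SLESixMoebius Loewner
open scoped NNReal ENNReal Topology BoundedContinuousFunction

namespace Summit.CriticalPhenomena.CardyFormulaZ2.Theorems.CardyRotToConfR2SymmetryUpgrade

/-! ### Two measure-theoretic helpers -/

/-- **Descent of a.e.-measurability from a product**: if a measurable `g` on `α × β` agrees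
`μ ⊗ ν`-a.e. with `F ∘ fst` and `ν` is a probability measure, then `F` is `μ`-a.e. measurable
(fix a good second coordinate by Fubini). [folklore] -/
theorem aemeasurable_of_ae_eq_comp_fst {α β E : Type*} [MeasurableSpace α] [MeasurableSpace β]
    [MeasurableSpace E] {μ : Measure α} {ν : Measure β} [SFinite μ] [IsProbabilityMeasure ν]
    {g : α × β → E} (hg : Measurable g) {F : α → E} (h : ∀ᵐ p ∂μ.prod ν, g p = F p.1) :
    AEMeasurable F μ := by
  have h' : ∀ᵐ q ∂ν.prod μ, g q.swap = F q.swap.1 :=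
    (Measure.measurePreserving_swap (μ := ν) (ν := μ)).quasiMeasurePreserving.ae h
  have h'' : ∀ᵐ y ∂ν, ∀ᵐ a ∂μ, g (a, y) = F a := by
    simpa only [Prod.swap_prod_mk, Prod.fst] using Measure.ae_ae_of_ae_prod h'
  obtain ⟨y, hy⟩ := h''.exists
  exact ⟨fun a ↦ g (a, y), hg.comp (measurable_id.prodMk measurable_const),
    hy.mono fun a ha ↦ ha.symm⟩

/-- The integral over a product of a function of the first coordinate (second factor a
probability measure). [folklore] -/
theorem lintegral_comp_fst {α β : Type*} [MeasurableSpace α] [MeasurableSpace β]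
    {μ : Measure α} {ν : Measure β} [SFinite μ] [SFinite ν] [IsProbabilityMeasure ν]
    {f : α → ℝ≥0∞} (hf : AEMeasurable f μ) :
    ∫⁻ p, f p.1 ∂μ.prod ν = ∫⁻ a, f a ∂μ := by
  have h : (μ.prod ν).map Prod.fst = μ := by rw [Measure.map_fst_prod, measure_univ, one_smul]
  have hf' : AEMeasurable f ((μ.prod ν).map Prod.fst) := by rw [h]; exact hf
  rw [← lintegral_map' hf' measurable_fst.aemeasurable, h]

/-! ### Equality of the two stopped-class laws -/

/-- **Lawler's Thm. 6.13 / Prop. 6.14 for the Möbius map `Φ_x`, as an equality of laws.** For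
`x ≠ 0`, the maps `ω ↦ [Φ_x ∘ γ|[0, T₋]]` and `ω ↦ [γ|[0, T₊]]` (`γ` the SLE₆ trace of `ω`,
`T₋ = firstHit γ (realRay (-x))`, `T₊ = firstHit γ (realRay x)`, classes modulo reparametrisation)
are a.e. measurable on Wiener space and have the same law on `CurveClass ℂ`.
[cite: Lawler2005, §6.3 Thm. 6.13] -/
theorem sleSix_moebius_stoppedPathClass_law_eq {x : ℝ} (hx : x ≠ 0) :
    AEMeasurable (fun ω ↦ stoppedPathClass (retargetMoebius x) (sleTrace 6 ω)
        ((firstHit (sleTrace 6 ω) (realRay (-x))).untopD 0)) preWienerMeasure ∧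
      AEMeasurable (fun ω ↦ stoppedPathClass id (sleTrace 6 ω)
        ((firstHit (sleTrace 6 ω) (realRay x)).untopD 0)) preWienerMeasure ∧
      preWienerMeasure.map (fun ω ↦ stoppedPathClass (retargetMoebius x) (sleTrace 6 ω)
          ((firstHit (sleTrace 6 ω) (realRay (-x))).untopD 0)) =
        preWienerMeasure.map (fun ω ↦ stoppedPathClass id (sleTrace 6 ω)
          ((firstHit (sleTrace 6 ω) (realRay x)).untopD 0)) := by
  haveI := isProbabilityMeasure_preWienerMeasure'
  -- the two stopped classes and their approximants
  set F : (ℝ≥0 → ℝ) → CurveClass ℂ := fun ω ↦ stoppedPathClass (retargetMoebius x) (sleTrace 6 ω)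
    ((firstHit (sleTrace 6 ω) (realRay (-x))).untopD 0) with hFdef
  set G : (ℝ≥0 → ℝ) → CurveClass ℂ := fun ω ↦ stoppedPathClass id (sleTrace 6 ω)
    ((firstHit (sleTrace 6 ω) (realRay x)).untopD 0) with hGdef
  -- levels: `1/N < |x| < N` for `n ≥ n₀`
  obtain ⟨n₀, hn₀⟩ : ∃ n₀ : ℕ, ∀ n, n₀ ≤ n → 1 / level n < |x| ∧ |x| < level n := by
    have habs : 0 < |x| := abs_pos.2 hx
    obtain ⟨N₁, hN₁⟩ := exists_nat_gt (max |x| (1 / |x|))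
    refine ⟨N₁, fun n hn ↦ ?_⟩
    have hlev : (N₁ : ℝ) < level n := by
      unfold level; have : (N₁ : ℝ) ≤ n := by exact_mod_cast hn
      linarith
    have h1 : |x| < level n := (le_max_left _ _).trans_lt (hN₁.trans hlev)
    have h2 : 1 / |x| < level n := (le_max_right _ _).trans_lt (hN₁.trans hlev)
    have hlevpos : 0 < level n := by unfold level; positivity
    refine ⟨?_, h1⟩
    rw [div_lt_iff₀ hlevpos]
    rw [div_lt_iff₀ habs] at h2
    linarith
  set Fn : ℕ → (ℝ≥0 → ℝ) → CurveClass ℂ := fun k ω ↦ stoppedPathClass (retargetMoebius x)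
    (sleTrace 6 ω) ((locTime x (k + n₀) ω).untopD 0) with hFn
  set Gn : ℕ → (ℝ≥0 → ℝ) → CurveClass ℂ := fun k ω ↦
    stoppedTraceClass x (x ^ 2) (k + n₀) (sleDriving 6 ω) with hGn
  have hlev : ∀ k, 1 / level (k + n₀) < |x| ∧ |x| < level (k + n₀) := fun k ↦
    hn₀ _ (Nat.le_add_left _ _)
  -- measurability of the approximants
  have hGn_meas : ∀ k, Measurable (Gn k) := fun k ↦
    (measurable_stoppedTraceClass (hlev k).1 (hlev k).2).comp (measurable_pi_lambda _ (measurable_sleDriving 6))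
  have hFn_meas : ∀ k, AEMeasurable (Fn k) preWienerMeasure := by
    intro k
    obtain ⟨B, hB, hBm, hBc, hae⟩ := ae_stoppedPathClass_eq_stoppedTraceClass (hlev k).1 (hlev k).2
    have hpath : Measurable fun p : (ℝ≥0 → ℝ) × (ℝ≥0 → ℝ) ↦ fun s ↦ Real.sqrt 6 * B s p :=
      measurable_pi_lambda _ fun s ↦ (hBm s).const_mul _
    exact aemeasurable_of_ae_eq_comp_fst
      ((measurable_stoppedTraceClass (hlev k).1 (hlev k).2).comp hpath)
      (hae.mono fun p hp ↦ hp.symm)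
  -- equality of the laws of the approximants, tested on bounded continuous functions
  have hlaw : ∀ k (f : CurveClass ℂ →ᵇ ℝ≥0),
      ∫⁻ ω, f (Fn k ω) ∂preWienerMeasure = ∫⁻ ω, f (Gn k ω) ∂preWienerMeasure := by
    intro k f
    obtain ⟨B, hB, hBm, hBc, hae⟩ := ae_stoppedPathClass_eq_stoppedTraceClass (hlev k).1 (hlev k).2
    have hf : Measurable fun c : CurveClass ℂ ↦ (f c : ℝ≥0∞) :=
      ENNReal.continuous_coe.measurable.comp f.continuous.measurable
    have hpath : Measurable fun p : (ℝ≥0 → ℝ) × (ℝ≥0 → ℝ) ↦ fun s ↦ Real.sqrt 6 * B s p :=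
      measurable_pi_lambda _ fun s ↦ (hBm s).const_mul _
    have h𝒢 := measurable_stoppedTraceClass (b := x ^ 2) (hlev k).1 (hlev k).2
    -- through the product space
    have h1 : ∫⁻ ω, f (Fn k ω) ∂preWienerMeasure =
        ∫⁻ p, f (Fn k p.1) ∂preWienerMeasure.prod preWienerMeasure :=
      (lintegral_comp_fst (hf.comp_aemeasurable (hFn_meas k))).symm
    have h2 : ∫⁻ p, f (Fn k p.1) ∂preWienerMeasure.prod preWienerMeasure =
        ∫⁻ p, f (stoppedTraceClass x (x ^ 2) (k + n₀) (fun s ↦ Real.sqrt 6 * B s p))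
          ∂preWienerMeasure.prod preWienerMeasure :=
      lintegral_congr_ae (hae.mono fun p hp ↦ by simp only [hFn]; rw [hp])
    have h3 : ∫⁻ p, f (stoppedTraceClass x (x ^ 2) (k + n₀) (fun s ↦ Real.sqrt 6 * B s p))
          ∂preWienerMeasure.prod preWienerMeasure =
        ∫⁻ u, f (stoppedTraceClass x (x ^ 2) (k + n₀) u)
          ∂(preWienerMeasure.prod preWienerMeasure).map (fun p s ↦ Real.sqrt 6 * B s p) :=
      (lintegral_map (hf.comp h𝒢) hpath).symm
    have h4 : (preWienerMeasure.prod preWienerMeasure).map (fun p s ↦ Real.sqrt 6 * B s p) =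
        preWienerMeasure.map (sleDriving 6) := by
      have := map_eq_map_sleDriving_of_isPreBrownianReal hB.toIsPreBrownianReal hBm 6
      simpa using this
    have h5 : ∫⁻ u, f (stoppedTraceClass x (x ^ 2) (k + n₀) u) ∂preWienerMeasure.map (sleDriving 6) =
        ∫⁻ ω, f (Gn k ω) ∂preWienerMeasure :=
      lintegral_map (hf.comp h𝒢) (measurable_pi_lambda _ (measurable_sleDriving 6))
    rw [h1, h2, h3, h4, h5]
  -- almost sure inputs: generation by the trace, finite swallowing times, no visit of the pole
  have hgen : ∀ᵐ ω ∂preWienerMeasure, IsGeneratedByCurve (sleDriving 6 ω) (sleTrace 6 ω) := by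
    filter_upwards [hasSLETrace_of_ne_eight_apply (κ := 6) (by norm_num)] with ω hω
    exact isGeneratedByCurve_trace hω
  have hfinm := ae_sle_swallowingTime_ofReal_lt_top (κ := 6) (by norm_num) (neg_ne_zero.2 hx)
  have hfinp := ae_sle_swallowingTime_ofReal_lt_top (κ := 6) (by norm_num) hx
  have hpole : ∀ᵐ ω ∂preWienerMeasure, ((-x : ℝ) : ℂ) ∉ range (sleTrace 6 ω) :=
    ae_notMem_range_sleTrace (κ := 6) (by norm_num) (by norm_num) (by simp)
      (by exact_mod_cast neg_ne_zero.2 hx)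
  -- almost sure convergence of the approximants
  have hFlim : ∀ᵐ ω ∂preWienerMeasure, Tendsto (fun k ↦ Fn k ω) atTop (𝓝 (F ω)) := by
    filter_upwards [hgen, hfinm, hpole] with ω hω hTfin hp
    obtain ⟨Tm, hTm⟩ := WithTop.ne_top_iff_exists.1 hTfin.ne
    have hhit : swallowingTime (sleDriving 6 ω) ((-x : ℝ) : ℂ) =
        firstHit (sleTrace 6 ω) (realRay (-x)) :=
      swallowingTime_ofReal_eq_firstHit_of_ne (continuous_sleDriving 6 ω) (sleDriving_zero 6 ω) hω
        (neg_ne_zero.2 hx)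
    -- `Φ_x ∘ γ` is continuous since `γ` avoids the pole
    have hcont : Continuous (retargetMoebius x ∘ sleTrace 6 ω) := by
      refine continuous_iff_continuousAt.2 fun t ↦ (retargetMoebius.continuousAt ?_).comp
        hω.continuous.continuousAt
      intro h
      exact hp ⟨t, by rw [h]; push_cast; rfl⟩
    have hF : F ω = stoppedClass ⟨_, hcont⟩ Tm := by
      simp only [hFdef]
      rw [← hhit, ← hTm, WithTop.untopD_coe, stoppedPathClass_eq_stoppedClass hcont]
    have hFk : ∀ k, Fn k ω = stoppedClass ⟨_, hcont⟩ ((locTime x (k + n₀) ω).untopD 0) := fun k ↦ by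
      simp only [hFn]; rw [stoppedPathClass_eq_stoppedClass hcont]
    rw [hF]
    simp only [hFk]
    exact ((continuous_stoppedClass ⟨_, hcont⟩).tendsto Tm).comp
      ((tendsto_locTime hx ω hTm.symm).comp (tendsto_add_atTop_nat n₀))
  have hGlim : ∀ᵐ ω ∂preWienerMeasure, Tendsto (fun k ↦ Gn k ω) atTop (𝓝 (G ω)) := by
    filter_upwards [hgen, hfinp] with ω hω hTfin
    obtain ⟨Tp, hTp⟩ := WithTop.ne_top_iff_exists.1 hTfin.ne
    have hW : Continuous (sleDriving 6 ω) := continuous_sleDriving 6 ω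
    have hW0 : sleDriving 6 ω 0 = 0 := sleDriving_zero 6 ω
    have hhit : swallowingTime (sleDriving 6 ω) (x : ℂ) = firstHit (sleTrace 6 ω) (realRay x) :=
      swallowingTime_ofReal_eq_firstHit_of_ne hW hW0 hω hx
    have hreg : regPath (sleDriving 6 ω) = sleDriving 6 ω := regPath_eq_self hW hW0
    have hγc : Continuous (id ∘ sleTrace 6 ω) := hω.continuous
    have htrc : Continuous (trace (sleDriving 6 ω)) := hω.continuous
    have hG : G ω = stoppedClass ⟨_, hγc⟩ Tp := by
      simp only [hGdef]
      rw [← hhit, ← hTp, WithTop.untopD_coe, stoppedPathClass_eq_stoppedClass hγc]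
    have hGk : ∀ k, Gn k ω = stoppedClass ⟨_, hγc⟩
        ((pointLocTime x (x ^ 2) (k + n₀) (sleDriving 6 ω)).untopD 0) := fun k ↦ by
      simp only [hGn]
      rw [stoppedTraceClass_eq_of_continuous hW hW0 htrc]
      exact stoppedPathClass_eq_stoppedClass hγc _
    rw [hG]
    simp only [hGk]
    refine ((continuous_stoppedClass ⟨_, hγc⟩).tendsto Tp).comp ?_
    have hlim := tendsto_pointLocTime hx (sleDriving 6 ω) (T := Tp) (by rw [hreg]; exact hTp.symm)
    exact hlim.comp (tendsto_add_atTop_nat n₀)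
  -- a.e.-measurability of the limits
  have hFm : AEMeasurable F preWienerMeasure := aemeasurable_of_tendsto_metrizable_ae' hFn_meas hFlim
  have hGm : AEMeasurable G preWienerMeasure :=
    aemeasurable_of_tendsto_metrizable_ae' (fun k ↦ (hGn_meas k).aemeasurable) hGlim
  -- equality of the laws
  have hmap : preWienerMeasure.map F = preWienerMeasure.map G := by
    refine ext_of_forall_lintegral_eq_of_IsFiniteMeasure fun f ↦ ?_
    have hf : Measurable fun c : CurveClass ℂ ↦ (f c : ℝ≥0∞) :=
      ENNReal.continuous_coe.measurable.comp f.continuous.measurable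
    have hfc : Continuous fun c : CurveClass ℂ ↦ (f c : ℝ≥0∞) :=
      ENNReal.continuous_coe.comp f.continuous
    rw [lintegral_map' hf.aemeasurable hFm, lintegral_map' hf.aemeasurable hGm]
    have hbound : ∀ c : CurveClass ℂ, (f c : ℝ≥0∞) ≤ (nndist f 0 : ℝ≥0∞) := fun c ↦
      ENNReal.coe_le_coe.2 (BoundedContinuousFunction.NNReal.upper_bound f c)
    have hfinI : ∫⁻ _ : ℝ≥0 → ℝ, (nndist f 0 : ℝ≥0∞) ∂preWienerMeasure ≠ ∞ := by
      rw [lintegral_const, measure_univ, mul_one]; exact ENNReal.coe_ne_top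
    have hlimF : Tendsto (fun k ↦ ∫⁻ ω, (f (Fn k ω) : ℝ≥0∞) ∂preWienerMeasure) atTop
        (𝓝 (∫⁻ ω, (f (F ω) : ℝ≥0∞) ∂preWienerMeasure)) :=
      tendsto_lintegral_of_dominated_convergence' (fun _ ↦ (nndist f 0 : ℝ≥0∞))
        (fun k ↦ hf.comp_aemeasurable (hFn_meas k)) (fun k ↦ ae_of_all _ fun ω ↦ hbound _) hfinI
        (hFlim.mono fun ω hω ↦ (hfc.tendsto _).comp hω)
    have hlimG : Tendsto (fun k ↦ ∫⁻ ω, (f (Gn k ω) : ℝ≥0∞) ∂preWienerMeasure) atTop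
        (𝓝 (∫⁻ ω, (f (G ω) : ℝ≥0∞) ∂preWienerMeasure)) :=
      tendsto_lintegral_of_dominated_convergence' (fun _ ↦ (nndist f 0 : ℝ≥0∞))
        (fun k ↦ (hf.comp (hGn_meas k)).aemeasurable) (fun k ↦ ae_of_all _ fun ω ↦ hbound _) hfinI
        (hGlim.mono fun ω hω ↦ (hfc.tendsto _).comp hω)
    have heq : (fun k ↦ ∫⁻ ω, (f (Fn k ω) : ℝ≥0∞) ∂preWienerMeasure) =
        fun k ↦ ∫⁻ ω, (f (Gn k ω) : ℝ≥0∞) ∂preWienerMeasure := funext fun k ↦ hlaw k f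
    rw [heq] at hlimF
    exact tendsto_nhds_unique hlimF hlimG
  exact ⟨hFm, hGm, hmap⟩

/-- **Target-independence of chordal SLE₆ in `(ℍ; 0, x, ∞)`** (Lawler (2005), Thm. 6.13 with
Prop. 6.14), the registered stub: the law of the class of `Φ_x ∘ γ` run until the SLE₆ trace `γ`
hits `(-∞, -x]` equals the law of the class of `γ` run until it hits `[x, ∞)`, on every
measurable set of classes. [cite: Lawler2005, §6.3 Thm. 6.13] -/
theorem stub_sleSixMoebiusLocality : Literature.Probability.RandomPlanarGeometry.sle_six_moebius_locality := by
  intro x hx T hT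
  obtain ⟨hF, hG, hmap⟩ := sleSix_moebius_stoppedPathClass_law_eq hx
  have h1 := Measure.map_apply_of_aemeasurable hF hT
  have h2 := Measure.map_apply_of_aemeasurable hG hT
  rw [hmap] at h1
  exact h1.symm.trans h2

end Summit.CriticalPhenomena.CardyFormulaZ2.Theorems.CardyRotToConfR2SymmetryUpgrade

end
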